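import Literature.NumberTheory.LFunctions.Zhang2022.Section10ClosedForm
import Literature.NumberTheory.LFunctions.Zhang2022.Section18Certificate

/-!
# Zhang (2022) §10 and (2.33): kernel-checked enclosures of `𝔡′`, `𝔡`, `d₇ⱼ`; the printed inequalities hold

Trunk T-ANT (NumberTheory/LFunctions). Companion of `Section10Defs.lean` / `Section10ClosedForm.lean`
(Y. Zhang, arXiv:2211.02515v1, §10 and §18 [Zhang2022LandauSiegel]; an unrefereed manuscript whose
claimed result is under adjudication — this file checks arithmetic on the printed definitions and
makes no statement about the manuscript's argument).

**Result (kernel-checked, axioms `propext`, `Classical.choice`, `Quot.sound` only).** With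
`d₃ⱼ, d₄ⱼ, d′₅ⱼ, d₅ⱼ, d′₆ⱼ, d₆ⱼ, 𝔡′, 𝔡` exactly as printed in §10 ((10.12)–(10.17)) and `ι₂, ι₃, ι₄`
as in (2.26):

* `dprime_re_bounds : 5.1459 < Re 𝔡′ < 5.14591`, `crude10_eq` with
  `crude10_overPi_bounds : 5.145881 < −(8/(0.498π))Re ι₃ < 5.145883`;
  hence `Ineq10a_holds : Re 𝔡′ > −(8/(0.498π))Re ι₃ − 0.04` and `Ineq10b_holds : … − 0.04 > 5.1` —
  the printed display "`Re{𝔡′} > −(8/(0.498π))Re{ι₃} − 0.04 > 5.1`" HOLDS (note that in fact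
  `Re 𝔡′ − (−(8/(0.498π))Re ι₃) = 2.5·10⁻⁵ > 0`: the `−0.04` slack is not needed);
* `dfrak_re_bounds : 0.012958 < Re 𝔡 < 0.012959`; hence `Ineq10c_holds : |Re 𝔡| < 0.1` and the
  Remark's `Ineq10d_holds : Re 𝔡 > 0` HOLD;
* `dsum_re_bounds : 5.15886 < Re(𝔡′ + 𝔡) < 5.15887`, `dsum_normSq_bounds : 28.0791 < |𝔡′ + 𝔡|² < 28.0792`
  (`|𝔡′ + 𝔡| = 5.29897…`); hence `Prop24Main_holds : |𝔡′ + 𝔡| > 5`, the main-order content of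
  Proposition 2.4 "`|Ξ₁*| > 5𝔞𝔓`" given (10.17);
* for the proof of (2.33) (§18): `d7_re_bounds : 318.3559 < Re d₇ⱼ < 318.356` (`j = 1, 2, 3`; with the
  verbatim `𝔶₁ⱼ`-reading `d7lit_re_bounds : 318.379 < Re < 318.37901`), `overPi1100_bounds :
  350.1408 < 1100/π`; hence `Ineq233a_holds`, `Ineq233aLit_holds` ("`Re Sⱼ(𝐚₂₃,𝐚₂₃) < 1100𝔞/log P`"),
  `S233_re_bounds : 1273.4238 < Re{½d₇₁ + 2d₇₂ + 3/2·d₇₃} < 1273.4239 < 4400/π = 1400.56…`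
  (`Ineq233b_holds`) and `Ineq233_holds : C₂₃₃ = 2546.84… < 3000` — all printed (2.33)-side bounds HOLD,
  with room (the manuscript's "crude bound" `1100` vs the value `318.36`).

So, of the three numerical inputs of the final contradiction of §2 — (2.32) [`𝔠₁ + 𝔠₂ + 2Re 𝔠₃ <
0.001`, see `Section8Certificate.not_ineq824`, `Section18Certificate`], Proposition 2.4 [this file]
and (2.33) [this file] — the §10 and (2.33) constants are as printed; the discrepancy of the
manuscript is confined to (8.24)/(2.32).

**Method.** As in `Section8Certificate`: `Section10ClosedForm` reduces everything to finitely many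
ring operations on rationals, `π`, `1/π`, `e^{θπi}` (`θ ∈ ℚ`) and `conj`; each closed form is mirrored
by a box computation in the verified fixed-point engine `Literature.Analysis.ValidatedNumerics`
(scale `2^48`), membership is proved by composing the engine's `mem` lemmas (`apply_rules`), and the
kernel evaluates the endpoint comparisons `cert10 : CertProp10` (`decide +kernel`). The enclosures of
`e^{θπi}` and `q/π` used here are TOTAL (`eIpiB`, `overPiB`: a failed range reduction / division would
fall back to the trivial boxes `[-1,1]²`, `[−|q|, |q|]`), so no validity flags are threaded.
Independent cross-check (not part of the proof; double precision, exact antiderivatives and Simpson):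
`𝔡′ = 5.1459074120 + 1.1653010518i`, `𝔡 = 0.0129584722 + 0.0451889430i`, `d₇ⱼ = 318.35596288 +
0.00011844i` (the real part is the same for `j = 1, 2, 3`).
-/

noncomputable section

open Complex Real ComplexConjugate
open Literature.Analysis.ValidatedNumerics.Numerics

namespace Literature.NumberTheory.LFunctions.Zhang2022

/-! ### Total enclosures of `e^{θπi}` and `q/π`; small constants -/

/-- `|x| ≤ 1 ⇒ x ∈ [-1, 1]` (scaled). [folklore] -/
theorem mem_pm1 {x : ℝ} (h : |x| ≤ 1) : FI.mem x ⟨-(SC : ℤ), SC⟩ := by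
  rw [abs_le] at h
  refine ⟨?_, ?_⟩ <;> push_cast <;> nlinarith [SC_pos, h.1, h.2]

/-- the box `[-1,1] + [-1,1]i` [folklore] -/
def unitCB : CB := ⟨⟨-(SC : ℤ), SC⟩, ⟨-(SC : ℤ), SC⟩⟩

/-- `e^{ix} ∈ unitCB`. [folklore] -/
theorem mem_unitCB (x : ℝ) : CB.mem (cexp ((x : ℂ) * I)) unitCB := by
  refine ⟨?_, ?_⟩
  · rw [Complex.exp_ofReal_mul_I_re]; exact mem_pm1 (Real.abs_cos_le_one x)
  · rw [Complex.exp_ofReal_mul_I_im]; exact mem_pm1 (Real.abs_sin_le_one x)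

/-- base enclosure of `e^{θπi}`: the engine's `expI`, made TOTAL (falls back to `unitCB` if the
engine declines). [folklore] -/
def eIpiB0 (θ : ℚ) : CB := (CB.expI (piMul θ)).getD unitCB

/-- `eIpi θ ∈ eIpiB0 θ`, unconditionally. [folklore] -/
theorem mem_eIpiB0 (θ : ℚ) : CB.mem (eIpi θ) (eIpiB0 θ) := by
  unfold eIpi eIpiB0
  cases hY : CB.expI (piMul θ) with
  | none => simpa using mem_unitCB ((θ : ℝ) * π)
  | some Y => simpa using CB.mem_expI hY (mem_piMul θ)

/-- TOTAL enclosure of `e^{θπi}`, evaluated as `(e^{θπi/16})^16` (four box squarings), so that the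
engine's degree-10 Taylor remainder is taken at a reduced argument `≤ 0.25` instead of up to `π/4`:
this sharpens `e^{θπi}` from `±4·10⁻⁹` to `≈ 10⁻¹³`, which the short-interval integrals of §10
(differences of two nearly equal primitive values) need. [folklore] -/
def eIpiB (θ : ℚ) : CB := ((((eIpiB0 (θ / 16)).sqr).sqr).sqr).sqr

/-- `e^{θπi} = ((((e^{θπi/16})²)²)²)²`. [folklore] -/
theorem eIpi_pow16 (θ : ℚ) : eIpi θ = ((((eIpi (θ / 16)) ^ 2) ^ 2) ^ 2) ^ 2 := by
  unfold eIpi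
  rw [← pow_mul, ← pow_mul, ← pow_mul, ← Complex.exp_nat_mul]
  congr 1; push_cast; ring

/-- `eIpi θ ∈ eIpiB θ`, unconditionally. [folklore] -/
theorem mem_eIpiB (θ : ℚ) : CB.mem (eIpi θ) (eIpiB θ) := by
  rw [eIpi_pow16]; unfold eIpiB
  exact CB.mem_sqr (CB.mem_sqr (CB.mem_sqr (CB.mem_sqr (mem_eIpiB0 (θ / 16)))))

/-- TOTAL enclosure of `q/π` (falls back to `[−|q|, |q|]`). [folklore] -/
def overPiB (q : ℚ) : FI :=
  (FI.divPos (FI.ofRat q) FI.pi).getD (FI.span (FI.ofRat (-|q|)) (FI.ofRat |q|))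

/-- `q/π ∈ overPiB q`, unconditionally. [folklore] -/
theorem mem_overPiB (q : ℚ) : FI.mem (overPi q) (overPiB q) := by
  unfold overPiB overPi
  cases hK : FI.divPos (FI.ofRat q) FI.pi with
  | some K => simpa using FI.mem_divPos hK (FI.mem_ofRat q) FI.mem_pi
  | none =>
    simp only [Option.getD_none]
    have hπ : (1 : ℝ) ≤ π := by linarith [Real.pi_gt_three]
    have h : |(q : ℝ) / π| ≤ |(q : ℝ)| := by
      rw [abs_div, abs_of_pos Real.pi_pos]; exact div_le_self (abs_nonneg _) hπ
    have h' := abs_le.mp h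
    apply FI.mem_span (FI.mem_ofRat (-|q|)) (FI.mem_ofRat |q|)
    · push_cast; exact h'.1
    · push_cast; exact h'.2

/-- `((q : ℝ) : ℂ) ∈ qCB q` (real-coercion shape). [folklore] -/
theorem mem_qCB' (q : ℚ) : CB.mem (((q : ℝ)) : ℂ) (qCB q) := CB.mem_ofFI (FI.mem_ofRat q)

/-- `θπ` as a complex number lies in the box of `piMul θ`. [folklore] -/
theorem mem_piMulC (θ : ℚ) : CB.mem ((((θ : ℝ) * π : ℝ)) : ℂ) (CB.ofFI (piMul θ)) :=
  CB.mem_ofFI (mem_piMul θ)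

/-- `q/π` as a complex number. [folklore] -/
theorem mem_overPiC (q : ℚ) : CB.mem (((overPi q : ℝ)) : ℂ) (CB.ofFI (overPiB q)) :=
  CB.mem_ofFI (mem_overPiB q)

/-- `-1 ∈ -[1]`. [folklore] -/
theorem mem_negOneCB : CB.mem (-1 : ℂ) (CB.ofInt 1).neg := CB.mem_neg mem_oneCB

/-- `π² ∈ pi·pi`. [folklore] -/
theorem mem_piSq : FI.mem (π * π) (FI.pi.mul FI.pi) := FI.mem_mul FI.mem_pi FI.mem_pi

/- Keep the interval primitives opaque to the unifier (as in `Section8Certificate`). -/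
attribute [local irreducible] CB.add CB.sub CB.mul CB.sqr CB.neg CB.conj CB.mulFI CB.mulI CB.mulInt
  CB.ofFI CB.ofInt CB.normSqFI CB.expI FI.add FI.sub FI.mul FI.neg FI.mulInt FI.divNat FI.divPos
  FI.ofRat FI.ofInt FI.pi qCB piMul eIpiB overPiB unitCB

/- The boxes `iota3B`, `iota4B` of `ι₃`, `ι₄` (`mem_iota3`, `mem_iota4`) are those of `Section18Certificate`. -/

/-! ### Box mirrors of the exp-polynomial records -/

/-- box mirror of `LinE` [folklore] -/
structure LinEB where
  /-- box of `u0` -/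
  u0 : CB
  /-- box of `u1` -/
  u1 : CB

/-- box mirror of `QuadP` [folklore] -/
structure QuadPB where
  /-- box of `v0` -/
  v0 : CB
  /-- box of `v1` -/
  v1 : CB
  /-- box of `v2` -/
  v2 : CB

/-- box mirror of `CubE` [folklore] -/
structure CubEB where
  /-- box of `c0` -/
  c0 : CB
  /-- box of `c1` -/
  c1 : CB
  /-- box of `c2` -/
  c2 : CB
  /-- box of `c3` -/
  c3 : CB

/-- componentwise membership [folklore] -/
def LinEB.Mem (t : LinE) (T : LinEB) : Prop := CB.mem t.u0 T.u0 ∧ CB.mem t.u1 T.u1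
/-- componentwise membership [folklore] -/
def QuadPB.Mem (q : QuadP) (Q : QuadPB) : Prop := CB.mem q.v0 Q.v0 ∧ CB.mem q.v1 Q.v1 ∧ CB.mem q.v2 Q.v2
/-- componentwise membership [folklore] -/
def CubEB.Mem (t : CubE) (T : CubEB) : Prop :=
  CB.mem t.c0 T.c0 ∧ CB.mem t.c1 T.c1 ∧ CB.mem t.c2 T.c2 ∧ CB.mem t.c3 T.c3

/-- box of `ffLin a` [folklore] -/
def ffLinB (a : ℚ) : LinEB := ⟨CB.ofInt 1, ((qCB a).mulFI FI.pi).mulI⟩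
/-- box of `gh0Lin r₀` [folklore] -/
def gh0LinB (r0 : ℚ) : LinEB := ⟨qCB r0, CB.ofInt 0⟩
/-- box of `gh1Lin r₁ b` [folklore] -/
def gh1LinB (r1 b : ℚ) : LinEB := ⟨qCB r1, ((qCB b).mulFI FI.pi).mulI⟩

/-- `ffLin a ∈ ffLinB a`. [folklore] -/
theorem mem_ffLinB (a : ℚ) : LinEB.Mem (ffLin a) (ffLinB a) := by
  constructor <;> dsimp only [ffLin, ffLinB] <;>
    apply_rules (maxDepth := 600) [mem_oneCB, CB.mem_mulI, CB.mem_mulFI, FI.mem_pi, mem_qCB]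
/-- `gh0Lin r₀ ∈ gh0LinB r₀`. [folklore] -/
theorem mem_gh0LinB (r0 : ℚ) : LinEB.Mem (gh0Lin r0) (gh0LinB r0) := by
  constructor <;> dsimp only [gh0Lin, gh0LinB] <;> apply_rules (maxDepth := 600) [mem_zeroCB, mem_qCB]
/-- `gh1Lin r₁ b ∈ gh1LinB r₁ b`. [folklore] -/
theorem mem_gh1LinB (r1 b : ℚ) : LinEB.Mem (gh1Lin r1 b) (gh1LinB r1 b) := by
  constructor <;> dsimp only [gh1Lin, gh1LinB] <;>
    apply_rules (maxDepth := 600) [CB.mem_mulI, CB.mem_mulFI, FI.mem_pi, mem_qCB]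

/-- box mirror of `LinE.shift` [folklore] -/
def LinEB.shift (T : LinEB) (m s : ℚ) : LinEB :=
  ⟨(eIpiB (m * s)).mul (T.u0.add (T.u1.mulFI (FI.ofRat s))), (eIpiB (m * s)).mul T.u1⟩
/-- box mirror of `LinE.reflect` [folklore] -/
def LinEB.reflect (T : LinEB) (m c : ℚ) : LinEB :=
  ⟨(eIpiB (m * c)).mul (T.u0.add (T.u1.mulFI (FI.ofRat c))), ((eIpiB (m * c)).mul T.u1).neg⟩
/-- box mirror of `LinE.mulQ` [folklore] -/
def LinEB.mulQ (T : LinEB) (Q : QuadPB) : CubEB :=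
  ⟨T.u0.mul Q.v0, (T.u0.mul Q.v1).add (T.u1.mul Q.v0), (T.u0.mul Q.v2).add (T.u1.mul Q.v1), T.u1.mul Q.v2⟩
/-- box mirror of `LinE.toCubE` [folklore] -/
def LinEB.toCubE (T : LinEB) : CubEB := ⟨T.u0, T.u1, CB.ofInt 0, CB.ofInt 0⟩
/-- box mirror of `CubE.smul` [folklore] -/
def CubEB.smul (T : CubEB) (W : CB) : CubEB := ⟨W.mul T.c0, W.mul T.c1, W.mul T.c2, W.mul T.c3⟩
/-- box mirror of `CubE.add` [folklore] -/
def CubEB.add (T1 T2 : CubEB) : CubEB :=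
  ⟨T1.c0.add T2.c0, T1.c1.add T2.c1, T1.c2.add T2.c2, T1.c3.add T2.c3⟩
/-- box mirror of `CubE.sub` [folklore] -/
def CubEB.sub (T1 T2 : CubEB) : CubEB :=
  ⟨T1.c0.sub T2.c0, T1.c1.sub T2.c1, T1.c2.sub T2.c2, T1.c3.sub T2.c3⟩
/-- box mirror of `QuadP.reflect` [folklore] -/
def QuadPB.reflect (Q : QuadPB) (c : ℚ) : QuadPB :=
  ⟨(Q.v0.add (Q.v1.mulFI (FI.ofRat c))).add (Q.v2.mulFI (FI.ofRat (c * c))),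
   (Q.v1.add (Q.v2.mulFI (FI.ofRat (2 * c)))).neg, Q.v2⟩
/-- box mirror of `QuadP.constAdd` [folklore] -/
def QuadPB.constAdd (C : CB) (Q : QuadPB) : QuadPB := ⟨C.add Q.v0, Q.v1, Q.v2⟩

/-- Soundness of `LinEB.shift`. [folklore] -/
theorem LinEB.mem_shift {t : LinE} {T : LinEB} (h : LinEB.Mem t T) (m s : ℚ) :
    LinEB.Mem (t.shift m s) (T.shift m s) := by
  obtain ⟨h0, h1⟩ := h
  constructor <;> dsimp only [LinE.shift, LinEB.shift] <;>
    apply_rules (maxDepth := 600) [CB.mem_mul, CB.mem_add, CB.mem_mulFI, FI.mem_ofRat, mem_eIpiB]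
/-- Soundness of `LinEB.reflect`. [folklore] -/
theorem LinEB.mem_reflect {t : LinE} {T : LinEB} (h : LinEB.Mem t T) (m c : ℚ) :
    LinEB.Mem (t.reflect m c) (T.reflect m c) := by
  obtain ⟨h0, h1⟩ := h
  constructor <;> dsimp only [LinE.reflect, LinEB.reflect] <;>
    apply_rules (maxDepth := 600) [CB.mem_mul, CB.mem_add, CB.mem_neg, CB.mem_mulFI, FI.mem_ofRat, mem_eIpiB]
/-- Soundness of `LinEB.mulQ`. [folklore] -/
theorem LinEB.mem_mulQ {t : LinE} {T : LinEB} {q : QuadP} {Q : QuadPB} (h : LinEB.Mem t T)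
    (hq : QuadPB.Mem q Q) : CubEB.Mem (t.mulQ q) (T.mulQ Q) := by
  obtain ⟨h0, h1⟩ := h
  obtain ⟨g0, g1, g2⟩ := hq
  refine ⟨?_, ?_, ?_, ?_⟩ <;> dsimp only [LinE.mulQ, LinEB.mulQ] <;>
    apply_rules (maxDepth := 600) [CB.mem_mul, CB.mem_add]
/-- Soundness of `LinEB.toCubE`. [folklore] -/
theorem LinEB.mem_toCubE {t : LinE} {T : LinEB} (h : LinEB.Mem t T) :
    CubEB.Mem t.toCubE T.toCubE := by
  obtain ⟨h0, h1⟩ := h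
  refine ⟨?_, ?_, ?_, ?_⟩ <;> dsimp only [LinE.toCubE, LinEB.toCubE] <;>
    apply_rules (maxDepth := 600) [mem_zeroCB]
/-- Soundness of `CubEB.smul`. [folklore] -/
theorem CubEB.mem_smul {t : CubE} {T : CubEB} {w : ℂ} {W : CB} (h : CubEB.Mem t T)
    (hw : CB.mem w W) : CubEB.Mem (t.smul w) (T.smul W) := by
  obtain ⟨h0, h1, h2, h3⟩ := h
  refine ⟨?_, ?_, ?_, ?_⟩ <;> dsimp only [CubE.smul, CubEB.smul] <;> apply_rules (maxDepth := 600) [CB.mem_mul]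
/-- Soundness of `CubEB.add`. [folklore] -/
theorem CubEB.mem_add {t1 t2 : CubE} {T1 T2 : CubEB} (h1 : CubEB.Mem t1 T1) (h2 : CubEB.Mem t2 T2) :
    CubEB.Mem (t1.add t2) (T1.add T2) := by
  obtain ⟨a0, a1, a2, a3⟩ := h1
  obtain ⟨b0, b1, b2, b3⟩ := h2
  refine ⟨?_, ?_, ?_, ?_⟩ <;> dsimp only [CubE.add, CubEB.add] <;> apply_rules (maxDepth := 600) [CB.mem_add]
/-- Soundness of `CubEB.sub`. [folklore] -/
theorem CubEB.mem_sub {t1 t2 : CubE} {T1 T2 : CubEB} (h1 : CubEB.Mem t1 T1) (h2 : CubEB.Mem t2 T2) :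
    CubEB.Mem (t1.sub t2) (T1.sub T2) := by
  obtain ⟨a0, a1, a2, a3⟩ := h1
  obtain ⟨b0, b1, b2, b3⟩ := h2
  refine ⟨?_, ?_, ?_, ?_⟩ <;> dsimp only [CubE.sub, CubEB.sub] <;> apply_rules (maxDepth := 600) [CB.mem_sub]
/-- Soundness of `QuadPB.reflect`. [folklore] -/
theorem QuadPB.mem_reflect {q : QuadP} {Q : QuadPB} (h : QuadPB.Mem q Q) (c : ℚ) :
    QuadPB.Mem (q.reflect c) (Q.reflect c) := by
  obtain ⟨g0, g1, g2⟩ := h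
  refine ⟨?_, ?_, ?_⟩ <;> dsimp only [QuadP.reflect, QuadPB.reflect] <;>
    apply_rules (maxDepth := 600) [CB.mem_add, CB.mem_neg, CB.mem_mulFI, FI.mem_ofRat]
/-- Soundness of `QuadPB.constAdd`. [folklore] -/
theorem QuadPB.mem_constAdd {c : ℂ} {C : CB} {q : QuadP} {Q : QuadPB} (hc : CB.mem c C)
    (h : QuadPB.Mem q Q) : QuadPB.Mem (QuadP.constAdd c q) (QuadPB.constAdd C Q) := by
  obtain ⟨g0, g1, g2⟩ := h
  refine ⟨?_, ?_, ?_⟩ <;> dsimp only [QuadP.constAdd, QuadPB.constAdd] <;> apply_rules (maxDepth := 600) [CB.mem_add]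

/-- box of `yy1Q s h` [folklore] -/
def yy1QB (s h : ℚ) : QuadPB :=
  ⟨((((qCB s).mulFI FI.pi).mulI).mulFI (FI.ofRat (-1/2))).add
      (((qCB h).mulFI (FI.pi.mul FI.pi)).mulFI (FI.ofRat (-31249/125000))),
   (((qCB s).mulFI FI.pi).mulI).add ((qCB h).mulFI (FI.pi.mul FI.pi)),
   ((qCB h).mulFI (FI.pi.mul FI.pi)).neg⟩
/-- box of `yy2Q s h` [folklore] -/
def yy2QB (s h : ℚ) : QuadPB :=
  ⟨((((qCB s).mulFI FI.pi).mulI).mulFI (FI.ofRat (63/125))).add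
      (((qCB h).mulFI (FI.pi.mul FI.pi)).mulFI (FI.ofRat (3969/15625))),
   (((qCB s).mulFI FI.pi).mulI).neg.add (((qCB h).mulFI (FI.pi.mul FI.pi)).mulFI (FI.ofRat (-126/125))),
   (qCB h).mulFI (FI.pi.mul FI.pi)⟩
/-- `yy1Q s h ∈ yy1QB s h`. [folklore] -/
theorem mem_yy1QB (s h : ℚ) : QuadPB.Mem (yy1Q s h) (yy1QB s h) := by
  refine ⟨?_, ?_, ?_⟩ <;> dsimp only [yy1Q, yy1QB] <;>
    apply_rules (maxDepth := 600) [CB.mem_add, CB.mem_neg, CB.mem_mulI, CB.mem_mulFI, FI.mem_ofRat, FI.mem_pi,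
      mem_piSq, mem_qCB]
/-- `yy2Q s h ∈ yy2QB s h`. [folklore] -/
theorem mem_yy2QB (s h : ℚ) : QuadPB.Mem (yy2Q s h) (yy2QB s h) := by
  refine ⟨?_, ?_, ?_⟩ <;> dsimp only [yy2Q, yy2QB] <;>
    apply_rules (maxDepth := 600) [CB.mem_add, CB.mem_neg, CB.mem_mulI, CB.mem_mulFI, FI.mem_ofRat, FI.mem_pi,
      mem_piSq, mem_qCB]

/-- box of `linH` [folklore] -/
def linHB : QuadPB := ⟨qCB (1/500), (CB.ofInt 1).neg, CB.ofInt 0⟩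
/-- box of `linZ` [folklore] -/
def linZB : QuadPB := ⟨CB.ofInt 0, CB.ofInt 1, CB.ofInt 0⟩
/-- `linH ∈ linHB`. [folklore] -/
theorem mem_linHB : QuadPB.Mem linH linHB := by
  refine ⟨?_, ?_, ?_⟩ <;> dsimp only [linH, linQ, linHB] <;>
    apply_rules (maxDepth := 600) [mem_qCB', mem_negOneCB, mem_zeroCB]
/-- `linZ ∈ linZB`. [folklore] -/
theorem mem_linZB : QuadPB.Mem linZ linZB := by
  refine ⟨?_, ?_, ?_⟩ <;> dsimp only [linZ, linQ, linZB] <;> apply_rules (maxDepth := 600) [mem_oneCB, mem_zeroCB]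

/-- box of `d7lin1 j` [folklore] -/
def d7lin1B (j : ℚ) : LinEB :=
  ⟨(CB.ofInt 1).neg.add ((((qCB j).mulFI FI.pi).mulI).mulFI (FI.ofRat (1/2))), (((qCB j).mulFI FI.pi).mulI).neg⟩
/-- box of `d7lin2 j` [folklore] -/
def d7lin2B (j : ℚ) : LinEB :=
  ⟨(CB.ofInt 1).sub ((((qCB j).mulFI FI.pi).mulI).mulFI (FI.ofRat (63/125))), ((qCB j).mulFI FI.pi).mulI⟩
/-- `d7lin1 j ∈ d7lin1B j`. [folklore] -/
theorem mem_d7lin1B (j : ℚ) : LinEB.Mem (d7lin1 j) (d7lin1B j) := by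
  constructor <;> dsimp only [d7lin1, d7lin1B] <;>
    apply_rules (maxDepth := 600) [CB.mem_add, CB.mem_neg, CB.mem_mulI, CB.mem_mulFI, FI.mem_ofRat, FI.mem_pi, mem_qCB,
      mem_negOneCB, mem_oneCB]
/-- `d7lin2 j ∈ d7lin2B j`. [folklore] -/
theorem mem_d7lin2B (j : ℚ) : LinEB.Mem (d7lin2 j) (d7lin2B j) := by
  constructor <;> dsimp only [d7lin2, d7lin2B] <;>
    apply_rules (maxDepth := 600) [CB.mem_sub, CB.mem_neg, CB.mem_mulI, CB.mem_mulFI, FI.mem_ofRat, FI.mem_pi, mem_qCB,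
      mem_oneCB]

/-! ### Box mirror of the exact integral `CubE.integ` -/

/-- box of `wOf m = −i(m⁻¹/π)` [folklore] -/
def wOfB (m : ℚ) : CB := ((CB.ofFI (overPiB m⁻¹)).mulI).neg
/-- `wOf m ∈ wOfB m`. [folklore] -/
theorem mem_wOfB (m : ℚ) : CB.mem (wOf m) (wOfB m) := by
  unfold wOf wOfB; apply_rules (maxDepth := 600) [CB.mem_neg, CB.mem_mulI, mem_overPiC]

/-- box mirror of `CubE.A3` [folklore] -/
def CubEB.A3 (T : CubEB) (W : CB) : CB := W.mul T.c3
/-- box mirror of `CubE.A2` [folklore] -/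
def CubEB.A2 (T : CubEB) (W : CB) : CB := W.mul (T.c2.sub ((T.A3 W).mulInt 3))
/-- box mirror of `CubE.A1` [folklore] -/
def CubEB.A1 (T : CubEB) (W : CB) : CB := W.mul (T.c1.sub ((T.A2 W).mulInt 2))
/-- box mirror of `CubE.A0` [folklore] -/
def CubEB.A0 (T : CubEB) (W : CB) : CB := W.mul (T.c0.sub (T.A1 W))
/-- box mirror of `CubE.primAt` at a rational point [folklore] -/
def CubEB.primAt (T : CubEB) (W : CB) (x : ℚ) : CB :=
  (((T.A0 W).add ((T.A1 W).mulFI (FI.ofRat x))).add ((T.A2 W).mulFI ((FI.ofRat x).mul (FI.ofRat x)))).add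
    ((T.A3 W).mulFI (((FI.ofRat x).mul (FI.ofRat x)).mul (FI.ofRat x)))
/-- box mirror of `CubE.polyPrimAt` at a rational point [folklore] -/
def CubEB.polyPrimAt (T : CubEB) (x : ℚ) : CB :=
  (((T.c0.mulFI (FI.ofRat x)).add ((T.c1.mulFI ((FI.ofRat x).mul (FI.ofRat x))).mulFI (FI.ofRat (1/2)))).add
      ((T.c2.mulFI (((FI.ofRat x).mul (FI.ofRat x)).mul (FI.ofRat x))).mulFI (FI.ofRat (1/3)))).add
    ((T.c3.mulFI ((((FI.ofRat x).mul (FI.ofRat x)).mul (FI.ofRat x)).mul (FI.ofRat x))).mulFI (FI.ofRat (1/4)))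
/-- box mirror of `CubE.integ` [folklore] -/
def CubEB.integ (T : CubEB) (m A B : ℚ) : CB :=
  if m = 0 then (T.polyPrimAt B).sub (T.polyPrimAt A)
  else ((T.primAt (wOfB m) B).mul (eIpiB (m * B))).sub ((T.primAt (wOfB m) A).mul (eIpiB (m * A)))

/-- **Soundness of `CubEB.integ`**: `CubE.integ t m A B ∈ CubEB.integ T m A B`. [folklore] -/
theorem CubEB.mem_integ {t : CubE} {T : CubEB} (h : CubEB.Mem t T) (m A B : ℚ) :
    CB.mem (t.integ m A B) (T.integ m A B) := by
  obtain ⟨h0, h1, h2, h3⟩ := h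
  unfold CubE.integ CubEB.integ
  split_ifs with hm
  · unfold CubE.polyPrimAt CubEB.polyPrimAt
    apply_rules (maxDepth := 600) [CB.mem_add, CB.mem_sub, CB.mem_mulFI, FI.mem_mul, FI.mem_ofRat]
  · have hw := mem_wOfB m
    have hA3 : CB.mem (t.A3 (wOf m)) (T.A3 (wOfB m)) := by
      unfold CubE.A3 CubEB.A3; apply_rules (maxDepth := 600) [CB.mem_mul]
    have hA2 : CB.mem (t.A2 (wOf m)) (T.A2 (wOfB m)) := by
      unfold CubE.A2 CubEB.A2; apply_rules (maxDepth := 600) [CB.mem_mul, CB.mem_sub, CB.mem_mulInt]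
    have hA1 : CB.mem (t.A1 (wOf m)) (T.A1 (wOfB m)) := by
      unfold CubE.A1 CubEB.A1; apply_rules (maxDepth := 600) [CB.mem_mul, CB.mem_sub, CB.mem_mulInt]
    have hA0 : CB.mem (t.A0 (wOf m)) (T.A0 (wOfB m)) := by
      unfold CubE.A0 CubEB.A0; apply_rules (maxDepth := 600) [CB.mem_mul, CB.mem_sub]
    unfold CubE.primAt CubEB.primAt
    apply_rules (maxDepth := 600) [CB.mem_add, CB.mem_sub, CB.mem_mul, CB.mem_mulFI, FI.mem_mul, FI.mem_ofRat, mem_eIpiB]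

attribute [local irreducible] LinEB.shift LinEB.reflect LinEB.mulQ LinEB.toCubE CubEB.smul CubEB.add
  CubEB.sub QuadPB.reflect QuadPB.constAdd CubEB.integ ffLinB gh0LinB gh1LinB yy1QB yy2QB linHB linZB
  d7lin1B d7lin2B wOfB

/-! ### Boxes of the §10 / (2.33) constants -/

/-- box mirror of `d3val` [folklore] -/
@[irreducible] def d3valB (n a6 a7 s hh : ℚ) : CB :=
  (((CB.ofFI (piMul (n / 500))).neg.mul
      (((((ffLinB a6).shift (3/2) (1/250)).toCubE.smul (qCB (125/63))).integ (3/2) 0 (1/2)).add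
        (((ffLinB a7).toCubE.smul (iota2B.mulFI (FI.ofRat 2))).integ (5/2) 0 (1/2)))).add
    ((CB.ofFI (overPiB (62500/63))).mul
      (((ffLinB a6).toCubE.sub ((ffLinB a6).shift (3/2) (1/500)).toCubE).integ (3/2) 0 (1/500)))).add
    ((CB.ofFI (overPiB (62500/63))).mul
      (((((ffLinB a6).reflect (3/2) (63/125)).mulQ (yy1QB s hh)).integ (-(3/2)) (1/2) (251/500)).add
        ((((ffLinB a6).reflect (3/2) (63/125)).mulQ (yy2QB s hh)).integ (-(3/2)) (251/500) (63/125))))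

/-- `d3val … ∈ d3valB …`. [folklore] -/
theorem mem_d3valB (n a6 a7 s hh : ℚ) : CB.mem (d3val n a6 a7 s hh) (d3valB n a6 a7 s hh) := by
  unfold d3val d3valB
  apply_rules (maxDepth := 600) [CB.mem_add, CB.mem_sub, CB.mem_mul, CB.mem_neg, mem_piMulC, mem_overPiC,
    CubEB.mem_integ, CubEB.mem_smul, CubEB.mem_sub, LinEB.mem_toCubE, LinEB.mem_shift,
    LinEB.mem_reflect, LinEB.mem_mulQ, mem_ffLinB, mem_yy1QB, mem_yy2QB, mem_qCB', CB.mem_mulFI,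
    FI.mem_ofRat, mem_iota2]

/-- box mirror of `d4val` [folklore] -/
@[irreducible] def d4valB (j r0 r1 b : ℚ) : CB :=
  ((CB.ofFI (overPiB (62500/63))).mul
      ((((gh0LinB r0).toCubE.sub ((gh0LinB r0).shift 0 (1/500)).toCubE).integ 0 0 (1/500)).add
        (((gh1LinB r1 b).toCubE.sub ((gh1LinB r1 b).shift (-(3/2)) (1/500)).toCubE).integ
            (-(3/2)) 0 (1/500)))).sub
    (((qCB (j * (62500/63))).mulI).mul
      ((((((gh0LinB r0).shift 0 (1/500)).mulQ linHB).add ((gh0LinB r0).mulQ linZB)).integ 0 0 (1/500)).add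
        (((((gh1LinB r1 b).shift (-(3/2)) (1/500)).mulQ linHB).add ((gh1LinB r1 b).mulQ linZB)).integ
            (-(3/2)) 0 (1/500))))

/-- `d4val … ∈ d4valB …`. [folklore] -/
theorem mem_d4valB (j r0 r1 b : ℚ) : CB.mem (d4val j r0 r1 b) (d4valB j r0 r1 b) := by
  unfold d4val d4valB
  apply_rules (maxDepth := 600) [CB.mem_add, CB.mem_sub, CB.mem_mul, CB.mem_mulI, mem_overPiC, CubEB.mem_integ,
    CubEB.mem_add, CubEB.mem_sub, LinEB.mem_toCubE, LinEB.mem_shift, LinEB.mem_mulQ, mem_gh0LinB,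
    mem_gh1LinB, mem_linHB, mem_linZB, mem_qCB']

/-- box mirror of `d5pval` [folklore] -/
@[irreducible] def d5pvalB (r0 r1 b : ℚ) : CB :=
  (iota3B.mulFI (overPiB (250000/249))).neg.mul
    (((gh0LinB r0).toCubE.integ 0 0 (1/500)).add ((gh1LinB r1 b).toCubE.integ (-(3/2)) 0 (1/500)))

/-- `d5pval … ∈ d5pvalB …`. [folklore] -/
theorem mem_d5pvalB (r0 r1 b : ℚ) : CB.mem (d5pval r0 r1 b) (d5pvalB r0 r1 b) := by
  unfold d5pval d5pvalB
  apply_rules (maxDepth := 600) [CB.mem_add, CB.mem_mul, CB.mem_neg, CB.mem_mulFI, mem_overPiB, mem_iota3,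
    CubEB.mem_integ, LinEB.mem_toCubE, mem_gh0LinB, mem_gh1LinB]

/-- box mirror of `d5val` [folklore] -/
@[irreducible] def d5valB (j r0 r1 b r0' r1' b' : ℚ) : CB :=
  (((iota4B.mulFI (overPiB 1000)).mul
      ((((gh0LinB r0').toCubE.sub ((gh0LinB r0').shift 0 (1/500)).toCubE).integ 0 0 (1/500)).add
        (((gh1LinB r1' b').toCubE.sub ((gh1LinB r1' b').shift (-(5/2)) (1/500)).toCubE).integ
            (-(5/2)) 0 (1/500)))).sub
    ((((qCB (j * (250000/249))).mulI).mul iota3B).mul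
      ((((gh0LinB r0).mulQ linHB).integ 0 0 (1/500)).add
        (((gh1LinB r1 b).mulQ linHB).integ (-(3/2)) 0 (1/500))))).sub
    ((((qCB (j * 1000)).mulI).mul iota4B).mul
      ((((((gh0LinB r0').shift 0 (1/500)).mulQ linHB).add ((gh0LinB r0').mulQ linZB)).integ 0 0 (1/500)).add
        (((((gh1LinB r1' b').shift (-(5/2)) (1/500)).mulQ linHB).add ((gh1LinB r1' b').mulQ linZB)).integ
            (-(5/2)) 0 (1/500))))

/-- `d5val … ∈ d5valB …`. [folklore] -/
theorem mem_d5valB (j r0 r1 b r0' r1' b' : ℚ) :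
    CB.mem (d5val j r0 r1 b r0' r1' b') (d5valB j r0 r1 b r0' r1' b') := by
  unfold d5val d5valB
  apply_rules (maxDepth := 600) [CB.mem_add, CB.mem_sub, CB.mem_mul, CB.mem_mulI, CB.mem_mulFI, mem_overPiB, mem_iota3,
    mem_iota4, CubEB.mem_integ, CubEB.mem_add, CubEB.mem_sub, LinEB.mem_toCubE, LinEB.mem_shift,
    LinEB.mem_mulQ, mem_gh0LinB, mem_gh1LinB, mem_linHB, mem_linZB, mem_qCB']

/-- box mirror of `d6pval` [folklore] -/
@[irreducible] def d6pvalB (a6 : ℚ) : CB :=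
  (iota3B.conj.mulFI (overPiB (250000/249))).neg.mul ((ffLinB a6).toCubE.integ (3/2) 0 (1/500))

/-- `d6pval a ∈ d6pvalB a`. [folklore] -/
theorem mem_d6pvalB (a6 : ℚ) : CB.mem (d6pval a6) (d6pvalB a6) := by
  unfold d6pval d6pvalB
  apply_rules (maxDepth := 600) [CB.mem_mul, CB.mem_neg, CB.mem_mulFI, CB.mem_conj, mem_overPiB, mem_iota3,
    CubEB.mem_integ, LinEB.mem_toCubE, mem_ffLinB]

/-- box mirror of `d6val` [folklore] -/
@[irreducible] def d6valB (n a6 a7 s hh : ℚ) : CB :=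
  ((((CB.ofFI (piMul (n / 500))).neg.mul
      (((((ffLinB a6).shift (3/2) (1/500)).toCubE.smul (iota3B.conj.mulFI (FI.ofRat (500/249)))).integ
          (3/2) 0 (62/125)).add
        ((((ffLinB a7).shift (5/2) (1/250)).toCubE.smul (iota4B.conj.mulFI (FI.ofRat 2))).integ
          (5/2) 0 (62/125)))).add
    ((iota4B.conj.mulFI (overPiB 1000)).mul
      (((ffLinB a7).toCubE.sub ((ffLinB a7).shift (5/2) (1/500)).toCubE).integ (5/2) 0 (1/500)))).add
    ((CB.ofFI (overPiB 500)).mul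
      (((((ffLinB a6).mulQ ((yy1QB s hh).reflect (251/500))).smul
            (iota3B.conj.mulFI (FI.ofRat (500/249)))).integ (3/2) 0 (1/500)).add
        (((((ffLinB a7).shift (5/2) (1/500)).mulQ ((yy1QB s hh).reflect (251/500))).smul
            (iota4B.conj.mulFI (FI.ofRat 2))).integ (5/2) 0 (1/500))))).add
    ((iota4B.conj.mulFI (overPiB 1000)).mul
      (((ffLinB a7).mulQ ((yy2QB s hh).reflect (63/125))).integ (5/2) 0 (1/500)))

/-- `d6val … ∈ d6valB …`. [folklore] -/
theorem mem_d6valB (n a6 a7 s hh : ℚ) : CB.mem (d6val n a6 a7 s hh) (d6valB n a6 a7 s hh) := by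
  unfold d6val d6valB
  apply_rules (maxDepth := 600) [CB.mem_add, CB.mem_sub, CB.mem_mul, CB.mem_neg, CB.mem_mulFI, CB.mem_conj,
    mem_piMulC, mem_overPiC, mem_overPiB, mem_iota3, mem_iota4, CubEB.mem_integ, CubEB.mem_smul,
    CubEB.mem_sub, LinEB.mem_toCubE, LinEB.mem_shift, LinEB.mem_mulQ, QuadPB.mem_reflect,
    mem_ffLinB, mem_yy1QB, mem_yy2QB, FI.mem_ofRat]

/-- box mirror of `d7val` (the second `𝔶𝔶` box is passed in) [folklore] -/
@[irreducible] def d7valB (j s1 h1 : ℚ) (S2 : QuadPB) : CB :=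
  (CB.ofFI (overPiB 250000)).mul
    ((((d7lin1B j).mulQ (QuadPB.constAdd (CB.ofInt 1).neg (yy1QB s1 h1))).integ 0 (1/2) (251/500)).add
      (((d7lin2B j).mulQ (QuadPB.constAdd (CB.ofInt 1) S2)).integ 0 (251/500) (63/125)))

/-- `d7val … ∈ d7valB …` given a box for the second quadratic. [folklore] -/
theorem mem_d7valB (j s1 h1 s2 h2 : ℚ) {second : ℚ → ℚ → QuadP} {S2 : QuadPB}
    (hS : QuadPB.Mem (second s2 h2) S2) :
    CB.mem (d7val j s1 h1 s2 h2 second) (d7valB j s1 h1 S2) := by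
  unfold d7val d7valB
  apply_rules (maxDepth := 600) [CB.mem_add, CB.mem_mul, mem_overPiC, CubEB.mem_integ, LinEB.mem_mulQ,
    QuadPB.mem_constAdd, mem_d7lin1B, mem_d7lin2B, mem_yy1QB, mem_negOneCB, mem_oneCB]

/-! ### `𝔡′`, `𝔡`, the `d₇ⱼ` and their weighted sum -/

/-- `𝔡′` through the closed forms, with rational scalars as casts. [folklore] -/
theorem dprime_eq : dprime
    = ((1/2 : ℚ) : ℂ) * (d5pval (8/3) (-5/3) (-1/2) + conj (d6pval (1/2)))
      + ((2 : ℚ) : ℂ) * (d5pval (4/3) (-1/3) (1/2) + conj (d6pval (-1/2)))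
      + ((3/2 : ℚ) : ℂ) * (d5pval (8/9) (1/9) (1/6) + conj (d6pval (-3/2))) := by
  unfold dprime
  rw [d5p1_eq, d5p2_eq, d5p3_eq, d6p1_eq, d6p2_eq, d6p3_eq]
  push_cast; ring

/-- `𝔡` through the closed forms. [folklore] -/
theorem dfrak_eq : dfrak
    = ((1/2 : ℚ) : ℂ) * (d3val 6 (1/2) (3/2) 5 (-3) + d5val 1 (8/3) (-5/3) (-1/2) (24/25) (1/25) (1/10)
        + conj (d4val 1 (8/3) (-5/3) (-1/2) + d6val 6 (1/2) (3/2) 5 (-3)))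
      + ((2 : ℚ) : ℂ) * (d3val 3 (-1/2) (1/2) 4 (-3/2) + d5val 2 (4/3) (-1/3) (1/2) (12/25) (13/25) (3/10)
        + conj (d4val 2 (4/3) (-1/3) (1/2) + d6val 3 (-1/2) (1/2) 4 (-3/2)))
      + ((3/2 : ℚ) : ℂ) * (d3val 2 (-3/2) (-1/2) 3 (-1) + d5val 3 (8/9) (1/9) (1/6) (8/25) (17/25) (-3/10)
        + conj (d4val 3 (8/9) (1/9) (1/6) + d6val 2 (-3/2) (-1/2) 3 (-1))) := by
  unfold dfrak
  rw [d31_eq, d32_eq, d33_eq, d41_eq, d42_eq, d43_eq, d51_eq, d52_eq, d53_eq, d61_eq, d62_eq, d63_eq]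
  push_cast; ring

/-- box of `𝔡′` [folklore] -/
@[irreducible] def dprimeB : CB :=
  (((qCB (1/2)).mul ((d5pvalB (8/3) (-5/3) (-1/2)).add (d6pvalB (1/2)).conj)).add
    ((qCB 2).mul ((d5pvalB (4/3) (-1/3) (1/2)).add (d6pvalB (-1/2)).conj))).add
    ((qCB (3/2)).mul ((d5pvalB (8/9) (1/9) (1/6)).add (d6pvalB (-3/2)).conj))

/-- box of `𝔡` [folklore] -/
@[irreducible] def dfrakB : CB :=
  (((qCB (1/2)).mul (((d3valB 6 (1/2) (3/2) 5 (-3)).add (d5valB 1 (8/3) (-5/3) (-1/2) (24/25) (1/25) (1/10))).add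
      ((d4valB 1 (8/3) (-5/3) (-1/2)).add (d6valB 6 (1/2) (3/2) 5 (-3))).conj)).add
    ((qCB 2).mul (((d3valB 3 (-1/2) (1/2) 4 (-3/2)).add (d5valB 2 (4/3) (-1/3) (1/2) (12/25) (13/25) (3/10))).add
      ((d4valB 2 (4/3) (-1/3) (1/2)).add (d6valB 3 (-1/2) (1/2) 4 (-3/2))).conj))).add
    ((qCB (3/2)).mul (((d3valB 2 (-3/2) (-1/2) 3 (-1)).add (d5valB 3 (8/9) (1/9) (1/6) (8/25) (17/25) (-3/10))).add
      ((d4valB 3 (8/9) (1/9) (1/6)).add (d6valB 2 (-3/2) (-1/2) 3 (-1))).conj))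

/-- **`𝔡′ ∈ dprimeB`.** [folklore] -/
theorem mem_dprime : CB.mem dprime dprimeB := by
  rw [dprime_eq]; unfold dprimeB
  apply_rules (maxDepth := 600) [CB.mem_add, CB.mem_mul, CB.mem_conj, mem_qCB, mem_d5pvalB, mem_d6pvalB]

/-- **`𝔡 ∈ dfrakB`.** [folklore] -/
theorem mem_dfrak : CB.mem dfrak dfrakB := by
  rw [dfrak_eq]; unfold dfrakB
  apply_rules (maxDepth := 600) [CB.mem_add, CB.mem_mul, CB.mem_conj, mem_qCB, mem_d3valB, mem_d4valB, mem_d5valB,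
    mem_d6valB]

/-- box of `𝔡′ + 𝔡` [folklore] -/
@[irreducible] def dsumB : CB := dprimeB.add dfrakB
/-- `𝔡′ + 𝔡 ∈ dsumB`. [folklore] -/
theorem mem_dsum : CB.mem (dprime + dfrak) dsumB := by
  unfold dsumB; apply_rules (maxDepth := 600) [CB.mem_add, mem_dprime, mem_dfrak]

/-- boxes of `d₇ⱼ` (both readings) [folklore] -/
@[irreducible] def d71B : CB := d7valB 1 5 (-3) (yy2QB 5 (-3))
/-- see `d71B` [folklore] -/
@[irreducible] def d72B : CB := d7valB 2 4 (-3/2) (yy2QB 4 (-3/2))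
/-- see `d71B` [folklore] -/
@[irreducible] def d73B : CB := d7valB 3 3 (-1) (yy2QB 3 (-1))
/-- see `d71B` [folklore] -/
@[irreducible] def d7lit1B : CB := d7valB 1 5 (-3) (yy1QB 5 (-3))
/-- see `d71B` [folklore] -/
@[irreducible] def d7lit2B : CB := d7valB 2 4 (-3/2) (yy1QB 4 (-3/2))
/-- see `d71B` [folklore] -/
@[irreducible] def d7lit3B : CB := d7valB 3 3 (-1) (yy1QB 3 (-1))

/-- `d₇₁ ∈ d71B`. [folklore] -/
theorem mem_d71 : CB.mem d71 d71B := by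
  rw [d71_eq]; unfold d71B; exact_mod_cast mem_d7valB 1 5 (-3) 5 (-3) (mem_yy2QB 5 (-3))
/-- `d₇₂ ∈ d72B`. [folklore] -/
theorem mem_d72 : CB.mem d72 d72B := by
  rw [d72_eq]; unfold d72B; exact_mod_cast mem_d7valB 2 4 (-3/2) 4 (-3/2) (mem_yy2QB 4 (-3/2))
/-- `d₇₃ ∈ d73B`. [folklore] -/
theorem mem_d73 : CB.mem d73 d73B := by
  rw [d73_eq]; unfold d73B; exact_mod_cast mem_d7valB 3 3 (-1) 3 (-1) (mem_yy2QB 3 (-1))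
/-- `d7lit1 ∈ d7lit1B`. [folklore] -/
theorem mem_d7lit1 : CB.mem d7lit1 d7lit1B := by
  rw [d7lit1_eq]; unfold d7lit1B; exact_mod_cast mem_d7valB 1 5 (-3) 5 (-3) (mem_yy1QB 5 (-3))
/-- `d7lit2 ∈ d7lit2B`. [folklore] -/
theorem mem_d7lit2 : CB.mem d7lit2 d7lit2B := by
  rw [d7lit2_eq]; unfold d7lit2B; exact_mod_cast mem_d7valB 2 4 (-3/2) 4 (-3/2) (mem_yy1QB 4 (-3/2))
/-- `d7lit3 ∈ d7lit3B`. [folklore] -/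
theorem mem_d7lit3 : CB.mem d7lit3 d7lit3B := by
  rw [d7lit3_eq]; unfold d7lit3B; exact_mod_cast mem_d7valB 3 3 (-1) 3 (-1) (mem_yy1QB 3 (-1))

/-- the weighted sum with rational scalars as casts. [folklore] -/
theorem S233_eq : 1 / 2 * d71 + 2 * d72 + 3 / 2 * d73
    = ((1/2 : ℚ) : ℂ) * d71 + ((2 : ℚ) : ℂ) * d72 + ((3/2 : ℚ) : ℂ) * d73 := by
  push_cast; ring
/-- box of the weighted sum [folklore] -/
@[irreducible] def S233B : CB := (((qCB (1/2)).mul d71B).add ((qCB 2).mul d72B)).add ((qCB (3/2)).mul d73B)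
/-- the weighted sum lies in `S233B`. [folklore] -/
theorem mem_S233 : CB.mem (1 / 2 * d71 + 2 * d72 + 3 / 2 * d73) S233B := by
  rw [S233_eq]; unfold S233B
  apply_rules (maxDepth := 600) [CB.mem_add, CB.mem_mul, mem_qCB, mem_d71, mem_d72, mem_d73]
/-- box of the weighted sum, verbatim reading [folklore] -/
@[irreducible] def S233litB : CB :=
  (((qCB (1/2)).mul d7lit1B).add ((qCB 2).mul d7lit2B)).add ((qCB (3/2)).mul d7lit3B)
/-- the verbatim-reading weighted sum lies in `S233litB`. [folklore] -/
theorem mem_S233lit : CB.mem (((1/2 : ℚ) : ℂ) * d7lit1 + ((2 : ℚ) : ℂ) * d7lit2 + ((3/2 : ℚ) : ℂ) * d7lit3)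
    S233litB := by
  unfold S233litB
  apply_rules (maxDepth := 600) [CB.mem_add, CB.mem_mul, mem_qCB, mem_d7lit1, mem_d7lit2, mem_d7lit3]

/-! ### Certificate -/

/-- The endpoint comparisons (thresholds `q·2^48` against the integer endpoints). [folklore] -/
def CertProp10 : Prop :=
  ((5.1459 : ℚ) * (SC : ℚ) < (dprimeB.re.lo : ℚ) ∧ (dprimeB.re.hi : ℚ) < (5.14591 : ℚ) * (SC : ℚ))
  ∧ ((1.1653 : ℚ) * (SC : ℚ) < (dprimeB.im.lo : ℚ) ∧ (dprimeB.im.hi : ℚ) < (1.165302 : ℚ) * (SC : ℚ))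
  ∧ ((0.012958 : ℚ) * (SC : ℚ) < (dfrakB.re.lo : ℚ) ∧ (dfrakB.re.hi : ℚ) < (0.012959 : ℚ) * (SC : ℚ))
  ∧ ((0.045188 : ℚ) * (SC : ℚ) < (dfrakB.im.lo : ℚ) ∧ (dfrakB.im.hi : ℚ) < (0.04519 : ℚ) * (SC : ℚ))
  ∧ ((5.15886 : ℚ) * (SC : ℚ) < (dsumB.re.lo : ℚ) ∧ (dsumB.re.hi : ℚ) < (5.15887 : ℚ) * (SC : ℚ))
  ∧ ((28.0791 : ℚ) * (SC : ℚ) < (dsumB.normSqFI.lo : ℚ) ∧ (dsumB.normSqFI.hi : ℚ) < (28.0792 : ℚ) * (SC : ℚ))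
  ∧ ((5.145881 : ℚ) * (SC : ℚ) < ((overPiB (20127/1245)).lo : ℚ)
      ∧ ((overPiB (20127/1245)).hi : ℚ) < (5.145883 : ℚ) * (SC : ℚ))
  ∧ ((318.3559 : ℚ) * (SC : ℚ) < (d71B.re.lo : ℚ) ∧ (d71B.re.hi : ℚ) < (318.356 : ℚ) * (SC : ℚ))
  ∧ ((318.3559 : ℚ) * (SC : ℚ) < (d72B.re.lo : ℚ) ∧ (d72B.re.hi : ℚ) < (318.356 : ℚ) * (SC : ℚ))
  ∧ ((318.3559 : ℚ) * (SC : ℚ) < (d73B.re.lo : ℚ) ∧ (d73B.re.hi : ℚ) < (318.356 : ℚ) * (SC : ℚ))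
  ∧ ((318.379 : ℚ) * (SC : ℚ) < (d7lit1B.re.lo : ℚ) ∧ (d7lit1B.re.hi : ℚ) < (318.37901 : ℚ) * (SC : ℚ))
  ∧ ((318.379 : ℚ) * (SC : ℚ) < (d7lit2B.re.lo : ℚ) ∧ (d7lit2B.re.hi : ℚ) < (318.37901 : ℚ) * (SC : ℚ))
  ∧ ((318.379 : ℚ) * (SC : ℚ) < (d7lit3B.re.lo : ℚ) ∧ (d7lit3B.re.hi : ℚ) < (318.37901 : ℚ) * (SC : ℚ))
  ∧ ((1273.4238 : ℚ) * (SC : ℚ) < (S233B.re.lo : ℚ) ∧ (S233B.re.hi : ℚ) < (1273.4239 : ℚ) * (SC : ℚ))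
  ∧ ((1273.516 : ℚ) * (SC : ℚ) < (S233litB.re.lo : ℚ) ∧ (S233litB.re.hi : ℚ) < (1273.51601 : ℚ) * (SC : ℚ))
  ∧ ((350.1408 : ℚ) * (SC : ℚ) < ((overPiB 1100).lo : ℚ) ∧ ((overPiB 1100).hi : ℚ) < (350.1409 : ℚ) * (SC : ℚ))
  ∧ ((1400.5634 : ℚ) * (SC : ℚ) < ((overPiB 4400).lo : ℚ) ∧ ((overPiB 4400).hi : ℚ) < (1400.5635 : ℚ) * (SC : ℚ))

/-- Decidability of the certificate comparisons. [folklore] -/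
instance : Decidable CertProp10 := by unfold CertProp10; infer_instance

/-- **The kernel check.** [folklore] -/
theorem cert10 : CertProp10 := by decide +kernel

/-- **`5.1459 < Re 𝔡′ < 5.14591`** (true value `5.1459074…`). [folklore] -/
theorem dprime_re_bounds : (5.1459 : ℝ) < dprime.re ∧ dprime.re < 5.14591 := by
  have h := cert10.1
  exact ⟨by exact_mod_cast lo_bound mem_dprime.1 h.1, by exact_mod_cast hi_bound mem_dprime.1 h.2⟩
/-- `1.1653 < Im 𝔡′ < 1.165302` (true value `1.1653010…`). [folklore] -/
theorem dprime_im_bounds : (1.1653 : ℝ) < dprime.im ∧ dprime.im < 1.165302 := by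
  have h := cert10.2.1
  exact ⟨by exact_mod_cast lo_bound mem_dprime.2 h.1, by exact_mod_cast hi_bound mem_dprime.2 h.2⟩
/-- **`0.012958 < Re 𝔡 < 0.012959`** (true value `0.01295847…`). [folklore] -/
theorem dfrak_re_bounds : (0.012958 : ℝ) < dfrak.re ∧ dfrak.re < 0.012959 := by
  have h := cert10.2.2.1
  exact ⟨by exact_mod_cast lo_bound mem_dfrak.1 h.1, by exact_mod_cast hi_bound mem_dfrak.1 h.2⟩
/-- `0.045188 < Im 𝔡 < 0.04519` (true value `0.0451889…`). [folklore] -/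
theorem dfrak_im_bounds : (0.045188 : ℝ) < dfrak.im ∧ dfrak.im < 0.04519 := by
  have h := cert10.2.2.2.1
  exact ⟨by exact_mod_cast lo_bound mem_dfrak.2 h.1, by exact_mod_cast hi_bound mem_dfrak.2 h.2⟩
/-- `5.15886 < Re(𝔡′ + 𝔡) < 5.15887`. [folklore] -/
theorem dsum_re_bounds : (5.15886 : ℝ) < (dprime + dfrak).re ∧ (dprime + dfrak).re < 5.15887 := by
  have h := cert10.2.2.2.2.1
  exact ⟨by exact_mod_cast lo_bound mem_dsum.1 h.1, by exact_mod_cast hi_bound mem_dsum.1 h.2⟩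
/-- `28.0791 < |𝔡′ + 𝔡|² < 28.0792` (so `|𝔡′ + 𝔡| = 5.29897…`). [folklore] -/
theorem dsum_normSq_bounds :
    (28.0791 : ℝ) < Complex.normSq (dprime + dfrak) ∧ Complex.normSq (dprime + dfrak) < 28.0792 := by
  have h := cert10.2.2.2.2.2.1
  have hm := CB.mem_normSqFI mem_dsum
  exact ⟨by exact_mod_cast lo_bound hm h.1, by exact_mod_cast hi_bound hm h.2⟩
/-- `5.145881 < (20127/1245)/π < 5.145883`, the value of `−(8/(0.498π))Re ι₃`. [folklore] -/
theorem crude10_overPi_bounds : (5.145881 : ℝ) < overPi (20127/1245) ∧ overPi (20127/1245) < 5.145883 := by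
  have h := cert10.2.2.2.2.2.2.1
  exact ⟨by exact_mod_cast lo_bound (mem_overPiB _) h.1, by exact_mod_cast hi_bound (mem_overPiB _) h.2⟩
/-- **`318.3559 < Re d₇ⱼ < 318.356`** for `j = 1, 2, 3` (true value `318.35596…` for each `j`). [folklore] -/
theorem d7_re_bounds : ((318.3559 : ℝ) < d71.re ∧ d71.re < 318.356) ∧ ((318.3559 : ℝ) < d72.re ∧ d72.re < 318.356)
    ∧ ((318.3559 : ℝ) < d73.re ∧ d73.re < 318.356) := by
  have h1 := cert10.2.2.2.2.2.2.2.1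
  have h2 := cert10.2.2.2.2.2.2.2.2.1
  have h3 := cert10.2.2.2.2.2.2.2.2.2.1
  exact ⟨⟨by exact_mod_cast lo_bound mem_d71.1 h1.1, by exact_mod_cast hi_bound mem_d71.1 h1.2⟩,
    ⟨by exact_mod_cast lo_bound mem_d72.1 h2.1, by exact_mod_cast hi_bound mem_d72.1 h2.2⟩,
    ⟨by exact_mod_cast lo_bound mem_d73.1 h3.1, by exact_mod_cast hi_bound mem_d73.1 h3.2⟩⟩
/-- `318.379 < Re d₇ⱼ < 318.37901` in the verbatim reading (`j = 1, 2, 3`). [folklore] -/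
theorem d7lit_re_bounds : ((318.379 : ℝ) < d7lit1.re ∧ d7lit1.re < 318.37901)
    ∧ ((318.379 : ℝ) < d7lit2.re ∧ d7lit2.re < 318.37901) ∧ ((318.379 : ℝ) < d7lit3.re ∧ d7lit3.re < 318.37901) := by
  have h1 := cert10.2.2.2.2.2.2.2.2.2.2.1
  have h2 := cert10.2.2.2.2.2.2.2.2.2.2.2.1
  have h3 := cert10.2.2.2.2.2.2.2.2.2.2.2.2.1
  exact ⟨⟨by exact_mod_cast lo_bound mem_d7lit1.1 h1.1, by exact_mod_cast hi_bound mem_d7lit1.1 h1.2⟩,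
    ⟨by exact_mod_cast lo_bound mem_d7lit2.1 h2.1, by exact_mod_cast hi_bound mem_d7lit2.1 h2.2⟩,
    ⟨by exact_mod_cast lo_bound mem_d7lit3.1 h3.1, by exact_mod_cast hi_bound mem_d7lit3.1 h3.2⟩⟩
/-- **`1273.4238 < Re{½d₇₁ + 2d₇₂ + 3/2·d₇₃} < 1273.4239`.** [folklore] -/
theorem S233_re_bounds : (1273.4238 : ℝ) < (1 / 2 * d71 + 2 * d72 + 3 / 2 * d73).re
    ∧ (1 / 2 * d71 + 2 * d72 + 3 / 2 * d73).re < 1273.4239 := by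
  have h := cert10.2.2.2.2.2.2.2.2.2.2.2.2.2.1
  exact ⟨by exact_mod_cast lo_bound mem_S233.1 h.1, by exact_mod_cast hi_bound mem_S233.1 h.2⟩
/-- `1273.516 < Re{…}` `< 1273.51601` in the verbatim reading. [folklore] -/
theorem S233lit_re_bounds :
    (1273.516 : ℝ) < (((1/2 : ℚ) : ℂ) * d7lit1 + ((2 : ℚ) : ℂ) * d7lit2 + ((3/2 : ℚ) : ℂ) * d7lit3).re
    ∧ (((1/2 : ℚ) : ℂ) * d7lit1 + ((2 : ℚ) : ℂ) * d7lit2 + ((3/2 : ℚ) : ℂ) * d7lit3).re < 1273.51601 := by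
  have h := cert10.2.2.2.2.2.2.2.2.2.2.2.2.2.2.1
  exact ⟨by exact_mod_cast lo_bound mem_S233lit.1 h.1, by exact_mod_cast hi_bound mem_S233lit.1 h.2⟩
/-- `350.1408 < 1100/π < 350.1409`. [folklore] -/
theorem overPi1100_bounds : (350.1408 : ℝ) < overPi 1100 ∧ overPi 1100 < 350.1409 := by
  have h := cert10.2.2.2.2.2.2.2.2.2.2.2.2.2.2.2.1
  exact ⟨by exact_mod_cast lo_bound (mem_overPiB _) h.1, by exact_mod_cast hi_bound (mem_overPiB _) h.2⟩
/-- `1400.5634 < 4400/π < 1400.5635`. [folklore] -/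
theorem overPi4400_bounds : (1400.5634 : ℝ) < overPi 4400 ∧ overPi 4400 < 1400.5635 := by
  have h := cert10.2.2.2.2.2.2.2.2.2.2.2.2.2.2.2.2
  exact ⟨by exact_mod_cast lo_bound (mem_overPiB _) h.1, by exact_mod_cast hi_bound (mem_overPiB _) h.2⟩

/-! ### The printed inequalities -/

/-- `Re ι₃ = −1.00635`. [folklore] -/
theorem iota3_re : iota3.re = -1.00635 := by
  rw [iota3_eq]; simp

/-- `−(8/(0.498π))Re ι₃ = (20127/1245)/π`. [folklore] -/
theorem crude10_eq : -(8 / (0.498 * π)) * iota3.re = overPi (20127/1245) := by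
  rw [iota3_re]; unfold overPi
  have hπ : (π : ℝ) ≠ 0 := Real.pi_ne_zero
  field_simp
  norm_num

/-- **The printed `Re{𝔡′} > −(8/(0.498π))Re{ι₃} − 0.04` holds.** [folklore] -/
theorem Ineq10a_holds : Ineq10a := by
  unfold Ineq10a
  rw [crude10_eq]
  linarith [crude10_overPi_bounds.2, dprime_re_bounds.1]

/-- **The printed `−(8/(0.498π))Re{ι₃} − 0.04 > 5.1` holds.** [folklore] -/
theorem Ineq10b_holds : Ineq10b := by
  unfold Ineq10b
  rw [crude10_eq]
  linarith [crude10_overPi_bounds.1]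

/-- **The printed `|Re{𝔡}| < 0.1` holds.** [folklore] -/
theorem Ineq10c_holds : Ineq10c := by
  unfold Ineq10c
  rw [abs_lt]
  constructor <;> linarith [dfrak_re_bounds.1, dfrak_re_bounds.2]

/-- **The Remark's `Re{𝔡} > 0` holds.** [folklore] -/
theorem Ineq10d_holds : Ineq10d := by
  unfold Ineq10d; linarith [dfrak_re_bounds.1]

/-- **`|𝔡′ + 𝔡| > 5`** (Proposition 2.4 at main order). [folklore] -/
theorem Prop24Main_holds : Prop24Main := by
  unfold Prop24Main
  exact lt_of_lt_of_le (by linarith [dsum_re_bounds.1]) (Complex.re_le_norm _)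

/-- **The crude bounds `Re d₇ⱼ < 1100/π` hold.** [folklore] -/
theorem Ineq233a_holds : Ineq233a := by
  unfold Ineq233a
  have hπ : (1100 : ℝ) / π = overPi 1100 := by unfold overPi; norm_num
  rw [hπ]
  obtain ⟨⟨_, a⟩, ⟨_, b⟩, ⟨_, c⟩⟩ := d7_re_bounds
  have l := overPi1100_bounds.1
  exact ⟨by linarith, by linarith, by linarith⟩

/-- The crude bounds also hold in the verbatim reading. [folklore] -/
theorem Ineq233aLit_holds : Ineq233aLit := by
  unfold Ineq233aLit
  have hπ : (1100 : ℝ) / π = overPi 1100 := by unfold overPi; norm_num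
  rw [hπ]
  obtain ⟨⟨_, a⟩, ⟨_, b⟩, ⟨_, c⟩⟩ := d7lit_re_bounds
  have l := overPi1100_bounds.1
  exact ⟨by linarith, by linarith, by linarith⟩

/-- **`Re{½d₇₁ + 2d₇₂ + 3/2·d₇₃} < 4400/π` holds.** [folklore] -/
theorem Ineq233b_holds : Ineq233b := by
  unfold Ineq233b
  have hπ : (4400 : ℝ) / π = overPi 4400 := by unfold overPi; norm_num
  rw [hπ]
  linarith [S233_re_bounds.2, overPi4400_bounds.1]

/-- **`C₂₃₃ < 3000` ((2.33) at main order) holds**; in fact `2546.8476 < C₂₃₃ < 2546.8478`. [folklore] -/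
theorem C233_bounds : (2546.8476 : ℝ) < C233 ∧ C233 < 2546.8478 := by
  unfold C233
  constructor <;> linarith [S233_re_bounds.1, S233_re_bounds.2]

/-- **(2.33) at main order: `C₂₃₃ < 3000`.** [folklore] -/
theorem Ineq233_holds : Ineq233 := by
  unfold Ineq233; linarith [C233_bounds.2]

end Literature.NumberTheory.LFunctions.Zhang2022

/-! ## `_holds` aliases (appended 2026-08-28, flt-inv gen 65)

The named fact(s) below are already theorems of THIS file under another name; the alias records the
discharge under the tree's exact naming convention `X_holds` (D-0026 bookkeeping: the proof term is the
existing theorem; no statement, definition or attribute is edited; no new named fact).  The ledger's debt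
table listed each as unproved (`ledger fact claim` GRANTED «status unproved», 2026-08-28T08:5xZ). -/

/-- `CertProp10` — the kernel certificate of the §10 enclosures of `𝔡′`, `𝔡`, `d₇ⱼ` ((10.12)–(10.17), (10.19), (2.33)) holds (`decide +kernel`) (`Literature.NumberTheory.LFunctions.Zhang2022.cert10`). [cite: Zhang2022LandauSiegel, §10 (10.12)–(10.19) and (2.33)] -/
theorem _root_.Literature.NumberTheory.LFunctions.Zhang2022.CertProp10_holds : _root_.Literature.NumberTheory.LFunctions.Zhang2022.CertProp10 :=
  _root_.Literature.NumberTheory.LFunctions.Zhang2022.cert10
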